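import Literature.NumberTheory.Sieve.GallagherGoodLevels
import Literature.NumberTheory.Sieve.MontgomeryVaughan1975GaussSums
import Literature.NumberTheory.Sieve.SmoothCharacterDecayBlocks
import Mathlib.Analysis.SpecialFunctions.Integrals.Basic
import HarnessLib

/-!
# The decay sum `D_χ(t) = ∑_{p ≤ y} p^{−α}(1 − Re(χ(p)p^{−it}))` at a good level

Topic `Literature/NumberTheory/Sieve`; a PROVED file toward
`Literature.NumberTheory.DiophantineGeometry.XYZUpperHalf` ([Harper2016, Cor. 1]; non-principal
characters on the major arcs). A natural number `y` is a GOOD LEVEL (`GoodLevel δ θ y`) when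
Gallagher's prime number theorem for characters holds individually in short intervals at level
`y^θ`: `‖∑#_{x−h<p≤x} χ(p) log p‖ ≤ δ (h + y^{1−θ})` for all primitive `χ` of conductor `≤ y^θ` and all
`x, h ≤ y` (for the trivial character `∑# = ∑ log p − h`). By the tree's
`MontgomeryVaughan1975.gallagher_at_good_level` (Gallagher's Theorem 7 at a level without exceptional
zero, Landau–Page), good levels with `δ = C e^{−c/θ}` exist beyond every `Y₀` (`exists_goodLevel`).

`decaySum_lower_bound_of_goodLevel`: at a good level with `δ ≤ 1/20`, `0 < θ ≤ 1/5`, for `y`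
large (explicit), every non-principal `χ (mod q')` with `q' ≤ y^θ`, `0 ≤ α ≤ 1` and `|t| ≤ y^{θ/2}/40`:

`(1/(4 log y)) ∫_{2y^{1−θ/2}+?}^{y} v^{−α} dv ≤ ∑_{p ≤ y} p^{−α} (1 − Re(χ(p) p^{−it}))`,

by `SmoothArcs.sum_blocks_decay_lower_bound` on the blocks of length `h = ⌈y^{1−θ}⌉` covering
`(y^{1−θ/2}, y]` (regularity from the `q = 1` term, cancellation from the primitive character
inducing `χ`, the block primes not dividing `q'`).

## References

* P. X. Gallagher, Invent. Math. 11 (1970), Theorem 7 [Gallagher1970].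
* A. J. Harper, Compositio Math. 152 (2016), Appendix [Harper2016].
-/

noncomputable section

open Finset Real Complex MeasureTheory
open scoped Classical

namespace Literature.NumberTheory.Sieve

namespace SmoothArcs

open MontgomeryVaughan1975

/-! ### Good levels -/

/-- `y` is a good level with parameters `(δ, θ)`: Gallagher's short-interval bound holds individually
for every primitive character of conductor `q ≤ y^θ` and all `x, h ≤ y`.
[cite: Gallagher1970, Theorem 7] -/
def GoodLevel (δ θ : ℝ) (y : ℕ) : Prop :=
  ∀ (q : ℕ) (χ : DirichletCharacter ℂ q), χ.IsPrimitive → 1 ≤ q → q ≤ ⌊(y : ℝ) ^ θ⌋₊ →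
    ∀ x h : ℕ, x ≤ y → h ≤ y → ‖gallagherTerm χ x h‖ ≤ δ * ((h : ℝ) + y / (y : ℝ) ^ θ)

/-- **Good levels exist beyond every `Y₀`** (`δ = C e^{−c/θ}`, `0 < θ ≤ c₄`).
[cite: Gallagher1970, Theorem 7] [cite: MontgomeryVaughan2007, Corollaries 11.8–11.10] -/
theorem exists_goodLevel :
    ∃ c : ℝ, 0 < c ∧ ∃ c₄ : ℝ, 0 < c₄ ∧ ∃ C : ℝ, ∀ θ : ℝ, 0 < θ → θ ≤ c₄ → ∀ Y₀ : ℕ,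
      ∃ y : ℕ, Y₀ ≤ y ∧ 2 ≤ y ∧ GoodLevel (C * Real.exp (-c / θ)) θ y := by
  obtain ⟨c, hc, c₄, hc₄, C, hG⟩ := gallagher_at_good_level
  refine ⟨c, hc, c₄, hc₄, C, fun θ hθ hθc Y₀ => ?_⟩
  obtain ⟨y, hyY, hy2, -, -, hsum⟩ := hG θ hθ hθc Y₀
  refine ⟨y, hyY, hy2, fun q χ hχ hq1 hqy x h hx hh => ?_⟩
  have hy0 : (0 : ℝ) < y := by exact_mod_cast lt_of_lt_of_le two_pos hy2
  have hyθ : 0 < (y : ℝ) ^ θ := Real.rpow_pos_of_pos hy0 _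
  have hw : 0 < (h : ℝ) + y / (y : ℝ) ^ θ := by positivity
  -- constant functions `x, h`
  have h1 := hsum (fun _ _ => x) (fun _ _ => h) (fun _ _ => hx) (fun _ _ => hh)
  -- the single term `(q, χ)` is at most the double sum
  have hterm : ((h : ℝ) + y / (y : ℝ) ^ θ)⁻¹ * ‖gallagherTerm χ x h‖ ≤ C * Real.exp (-c / θ) := by
    refine le_trans ?_ h1
    have hq : q ∈ Icc 1 ⌊(y : ℝ) ^ θ⌋₊ := Finset.mem_Icc.mpr ⟨hq1, hqy⟩
    refine le_trans ?_ (Finset.single_le_sum (f := fun q => ∑ χ : DirichletCharacter ℂ q with χ.IsPrimitive,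
        ((h : ℝ) + y / (y : ℝ) ^ θ)⁻¹ * ‖gallagherTerm χ x h‖)
      (fun q _ => Finset.sum_nonneg fun χ _ => by positivity) hq)
    have hχmem : χ ∈ (Finset.univ : Finset (DirichletCharacter ℂ q)).filter (fun χ => χ.IsPrimitive) :=
      Finset.mem_filter.mpr ⟨Finset.mem_univ _, hχ⟩
    exact Finset.single_le_sum (f := fun χ : DirichletCharacter ℂ q => ((h : ℝ) + y / (y : ℝ) ^ θ)⁻¹ * ‖gallagherTerm χ x h‖)
      (fun χ _ => by positivity) hχmem
  rw [inv_mul_le_iff₀ hw] at hterm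
  linarith [hterm]

/-! ### The block hypotheses at a good level -/

/-- For the trivial character mod 1: `gallagherTerm 1 x h = ∑_{x−h<p≤x} log p − h` (`h ≤ x`). [folklore] -/
theorem gallagherTerm_one {x h : ℕ} (hhx : h ≤ x) :
    gallagherTerm (1 : DirichletCharacter ℂ 1) x h = (((∑ p ∈ primeBlock (x - h) x, Real.log p) - h : ℝ) : ℂ) := by
  rw [gallagherTerm, if_pos rfl, charPrimeSum, Nat.card_Ioc, primeBlock]
  push_cast
  congr 1
  · refine Finset.sum_congr rfl fun p _ => ?_
    rw [MulChar.one_apply (isUnit_of_subsingleton _), one_mul]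
  · congr 1; omega

/-- A character and its primitive character agree at primes not dividing the modulus. [folklore] -/
theorem apply_eq_primitiveCharacter {q : ℕ} [NeZero q] (χ : DirichletCharacter ℂ q) {p : ℕ} (hp : p.Coprime q) :
    χ (p : ZMod q) = χ.primitiveCharacter (p : ZMod χ.conductor) := by
  conv_lhs => rw [← DirichletCharacter.changeLevel_primitiveCharacter χ]
  rw [changeLevel_apply_natCast χ.conductor_dvd_level χ.primitiveCharacter p, if_pos hp]

/-- Primes above the modulus are coprime to it. [folklore] -/
theorem coprime_of_prime_gt {p q : ℕ} (hp : p.Prime) (hq : 1 ≤ q) (hpq : q < p) : p.Coprime q :=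
  (Nat.Prime.coprime_iff_not_dvd hp).mpr (fun h => absurd (Nat.le_of_dvd (by omega) h) (not_le.mpr hpq))

/-! ### The Riemann sum over the blocks dominates the integral -/

/-- `∑_{j=1}^{J} h (y − (j−1)h)^{−α} ≥ ∫_{y−(J−1)h}^{y+h} v^{−α} dv` (`v ↦ v^{−α}` is decreasing; the block
`j` contributes `∫_{P_j}^{P_j+h} ≤ h P_j^{−α}`, `P_j = y − (j−1)h`). [folklore] -/
theorem integral_le_sum_blocks {y h J : ℕ} (hJ : J * h ≤ y) (hpos : 0 < y - J * h) {α : ℝ} (hα0 : 0 ≤ α) :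
    ∫ v in (((y - J * h + h : ℕ) : ℝ))..(((y + h : ℕ) : ℝ)), v ^ (-α) ≤
      ∑ j ∈ Finset.Icc 1 J, (h : ℝ) * (((y - (j - 1) * h : ℕ) : ℝ)) ^ (-α) := by
  -- endpoints `a k = y − (J−k)h + h… we use `a k = (y − (J − k) h : ℕ) + h` hmm; simpler: `a k := ((y - (J - k) * h + h : ℕ) : ℝ)`
  set a : ℕ → ℝ := fun k => (((y - (J - k) * h + h : ℕ)) : ℝ) with ha
  have ha0 : a 0 = ((y - J * h + h : ℕ) : ℝ) := by simp [ha]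
  have haJ : a J = ((y + h : ℕ) : ℝ) := by simp [ha]
  -- each piece
  have hkey : ∀ k < J, y - (J - (k + 1)) * h = y - (J - k) * h + h := by
    intro k hk
    have h1 : (J - k) * h ≤ y := le_trans (Nat.mul_le_mul_right h (Nat.sub_le J k)) hJ
    have h2 : J - k = (J - (k + 1)) + 1 := by omega
    have h3 : (J - k) * h = (J - (k + 1)) * h + h := by rw [h2]; ring
    rw [h3] at h1 ⊢
    omega
  have hstep : ∀ k < J, a (k + 1) = a k + h := by
    intro k hk
    simp only [ha]
    rw [hkey k hk]; push_cast; ring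
  have hapos : ∀ k ≤ J, 0 < a k := by
    intro k hk
    simp only [ha]
    have : 0 < y - (J - k) * h + h := by
      have h1 : y - J * h ≤ y - (J - k) * h := Nat.sub_le_sub_left (Nat.mul_le_mul_right h (Nat.sub_le J k)) y
      omega
    exact_mod_cast this
  have hint : ∀ k < J, IntervalIntegrable (fun v : ℝ => v ^ (-α)) volume (a k) (a (k + 1)) := by
    intro k hk
    refine (ContinuousOn.intervalIntegrable fun v hv => ?_)
    have hv0 : 0 < v := by
      rw [Set.uIcc_of_le (by rw [hstep k hk]; exact le_add_of_nonneg_right (Nat.cast_nonneg h))] at hv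
      exact lt_of_lt_of_le (hapos k hk.le) hv.1
    exact (Real.continuousAt_rpow_const v (-α) (Or.inl hv0.ne')).continuousWithinAt
  rw [← ha0, ← haJ, ← intervalIntegral.sum_integral_adjacent_intervals hint]
  -- reindex `k ↦ j = J − k`
  have hreindex : ∑ j ∈ Finset.Icc 1 J, (h : ℝ) * (((y - (j - 1) * h : ℕ) : ℝ)) ^ (-α) =
      ∑ k ∈ Finset.range J, (h : ℝ) * (((y - (J - (k + 1)) * h : ℕ) : ℝ)) ^ (-α) := by
    refine Finset.sum_nbij' (fun j => J - j) (fun k => J - k) ?_ ?_ ?_ ?_ ?_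
    · intro j hj; have := Finset.mem_Icc.mp hj; exact Finset.mem_range.mpr (by omega)
    · intro k hk; have := Finset.mem_range.mp hk; exact Finset.mem_Icc.mpr ⟨by omega, by omega⟩
    · intro j hj; have := Finset.mem_Icc.mp hj; omega
    · intro k hk; have := Finset.mem_range.mp hk; omega
    · intro j hj
      have := Finset.mem_Icc.mp hj
      have e : J - (J - j + 1) = j - 1 := by omega
      simp only [e]
  rw [hreindex]
  refine Finset.sum_le_sum fun k hk => ?_
  have hk' := Finset.mem_range.mp hk
  -- `∫_{a k}^{a k + h} v^{-α} ≤ h (a k)^{-α}`… but `a k = P + h` where `P = y − (J−k)h`; we compare with `P^{-α}`: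
  -- on `[a k, a (k+1)]` we have `v ≥ a k ≥ P := y − (J − k) h`, and `y − (J − (k+1)) h = P + h = a k`.
  have hPk : (((y - (J - (k + 1)) * h : ℕ) : ℝ)) = a k := by
    simp only [ha]
    rw [hkey k hk']
  rw [hPk, hstep k hk']
  have hak : 0 < a k := hapos k hk'.le
  calc ∫ v in a k..(a k + h), v ^ (-α) ≤ ∫ _ in a k..(a k + h), (a k) ^ (-α) := by
        refine intervalIntegral.integral_mono_on (le_add_of_nonneg_right (Nat.cast_nonneg h)) ?_ ?_ fun v hv => ?_
        · rw [← hstep k hk']; exact hint k hk'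
        · exact intervalIntegrable_const
        · exact Real.rpow_le_rpow_of_nonpos hak hv.1 (by linarith)
    _ = (h : ℝ) * (a k) ^ (-α) := by rw [intervalIntegral.integral_const, smul_eq_mul]; ring

set_option maxHeartbeats 1600000 in
/-- **The decay sum at a good level.** Let `y` be a good level (`GoodLevel δ₀ θ y`, `δ₀ ≤ 1/20`,
`0 < θ ≤ 1/5`) which is large: `log y ≥ 25`, `40(y^{1−θ} + 1) ≤ y^{1−θ/2}`, `y^θ + 1 ≤ y^{1−θ/2}`,
`3 y^{1−θ/2} ≤ y`. Then for every non-principal `χ (mod q')` with `q' ≤ y^θ`, `0 ≤ α ≤ 1` and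
`|t| ≤ y^{θ/2}/40`:
`(1/(4 log y)) ∫_{3 y^{1−θ/2}}^{y} v^{−α} dv ≤ ∑_{p ≤ y} p^{−α} (1 − Re(χ(p) p^{−it}))`.
[cite: Harper2016, Appendix] [cite: Gallagher1970, Theorem 7] -/
theorem decaySum_lower_bound_of_goodLevel {δ₀ θ : ℝ} {y : ℕ} (hgood : GoodLevel δ₀ θ y)
    (hδ₀ : 0 ≤ δ₀) (hδ₀' : δ₀ ≤ 1 / 20) (hθ0 : 0 < θ) (hθ : θ ≤ 1 / 5)
    (hy25 : 25 ≤ Real.log y) (hy40 : 40 * ((y : ℝ) ^ (1 - θ) + 1) ≤ (y : ℝ) ^ (1 - θ / 2))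
    (hyq : (y : ℝ) ^ θ + 1 ≤ (y : ℝ) ^ (1 - θ / 2)) (hy3 : 3 * (y : ℝ) ^ (1 - θ / 2) ≤ y)
    {q' : ℕ} [NeZero q'] (χ : DirichletCharacter ℂ q') (hχ : χ ≠ 1) (hq' : (q' : ℝ) ≤ (y : ℝ) ^ θ)
    {α : ℝ} (hα0 : 0 ≤ α) (hα1 : α ≤ 1) {t : ℝ} (ht : |t| ≤ (y : ℝ) ^ (θ / 2) / 40) :
    1 / (4 * Real.log y) * ∫ v in (3 * (y : ℝ) ^ (1 - θ / 2))..(y : ℝ), v ^ (-α) ≤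
      ∑ p ∈ Nat.primesLE y, (p : ℝ) ^ (-α) * (1 - (χ (p : ZMod q') * (p : ℂ) ^ (-((t : ℂ) * I))).re) := by
  -- ### basic quantities
  have hlogy0 : 0 < Real.log y := by linarith
  have hy1 : (1 : ℝ) < y := by
    by_contra h0; push Not at h0
    have := Real.log_nonpos (Nat.cast_nonneg y) h0; linarith
  have hy0 : (0 : ℝ) < y := by linarith
  set hr : ℝ := (y : ℝ) ^ (1 - θ) with hhr
  set Y₁r : ℝ := (y : ℝ) ^ (1 - θ / 2) with hY₁r
  have hhr1 : 1 ≤ hr := Real.one_le_rpow hy1.le (by linarith)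
  have hhr0 : 0 < hr := by linarith
  set h : ℕ := ⌈hr⌉₊ with hhdef
  have hh_ge : hr ≤ h := Nat.le_ceil hr
  have hh_le : (h : ℝ) ≤ hr + 1 := (Nat.ceil_lt_add_one hhr0.le).le
  have hh1 : 1 ≤ h := by
    have : (1 : ℝ) ≤ h := hhr1.trans hh_ge
    exact_mod_cast this
  set Y₁ : ℕ := ⌈Y₁r⌉₊ with hY₁def
  have hY₁r0 : 0 < Y₁r := Real.rpow_pos_of_pos hy0 _
  have hY₁_ge : Y₁r ≤ Y₁ := Nat.le_ceil _
  have hY₁_le : (Y₁ : ℝ) ≤ Y₁r + 1 := (Nat.ceil_lt_add_one hY₁r0.le).le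
  have hY₁y : Y₁ ≤ y := by
    have : (Y₁ : ℝ) ≤ y := by nlinarith [hY₁_le, hy3, hY₁r0]
    exact_mod_cast this
  set J : ℕ := (y - Y₁) / h with hJdef
  have hJh : J * h ≤ y - Y₁ := Nat.div_mul_le_self _ _
  have hJhy : J * h ≤ y := le_trans hJh (Nat.sub_le _ _)
  have hLge : Y₁ ≤ y - J * h := by omega
  have hLlt : y - J * h < Y₁ + h := by
    have : (y - Y₁) % h < h := Nat.mod_lt _ (by omega)
    have h2 : (y - Y₁) = J * h + (y - Y₁) % h := by rw [hJdef, mul_comm]; exact (Nat.div_add_mod _ _).symm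
    omega
  -- real versions
  have hLger : Y₁r ≤ ((y - J * h : ℕ) : ℝ) := by
    have : ((Y₁ : ℕ) : ℝ) ≤ ((y - J * h : ℕ) : ℝ) := by exact_mod_cast hLge
    exact hY₁_ge.trans this
  have hLpos : (0 : ℝ) < ((y - J * h : ℕ) : ℝ) := lt_of_lt_of_le hY₁r0 hLger
  have hLposN : 0 < y - J * h := by exact_mod_cast hLpos
  -- `20 h ≤ y − J h`
  have h20 : 20 * h ≤ y - J * h := by
    have : (20 : ℝ) * h ≤ ((y - J * h : ℕ) : ℝ) := by
      calc (20 : ℝ) * h ≤ 20 * (hr + 1) := by nlinarith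
        _ ≤ Y₁r := by linarith
        _ ≤ _ := hLger
    exact_mod_cast this
  -- `log (y − Jh) ≥ (1 − θ/2) log y ≥ 20` and `log y ≤ (10/9) log(y − Jh)`
  have hlogL : (1 - θ / 2) * Real.log y ≤ Real.log ((y - J * h : ℕ) : ℝ) := by
    have h1 : Real.log Y₁r = (1 - θ / 2) * Real.log y := by
      rw [hY₁r, Real.log_rpow hy0]
    rw [← h1]; exact Real.log_le_log hY₁r0 hLger
  have hlogL20 : 20 ≤ Real.log ((y - J * h : ℕ) : ℝ) := by nlinarith
  have hlogY : Real.log y ≤ 10 / 9 * Real.log ((y - J * h : ℕ) : ℝ) := by nlinarith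
  -- `|t| h ≤ (y − Jh)/20`
  have hth : |t| * h ≤ ((y - J * h : ℕ) : ℝ) / 20 := by
    have h1 : (y : ℝ) ^ (θ / 2) * hr = Y₁r := by
      rw [hhr, hY₁r, ← Real.rpow_add hy0]; ring_nf
    have h2 : |t| * h ≤ (y : ℝ) ^ (θ / 2) / 40 * (2 * hr) := by
      apply mul_le_mul ht (by linarith) (Nat.cast_nonneg h) (by positivity)
    calc |t| * h ≤ (y : ℝ) ^ (θ / 2) / 40 * (2 * hr) := h2
      _ = Y₁r / 20 := by rw [← h1]; ring
      _ ≤ _ := by linarith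
  -- ### the block hypotheses
  have hyθ1 : 1 ≤ (y : ℝ) ^ θ := Real.one_le_rpow hy1.le hθ0.le
  have hfloor1 : 1 ≤ ⌊(y : ℝ) ^ θ⌋₊ := Nat.le_floor (by simpa using hyθ1)
  have hyyθ : (y : ℝ) / (y : ℝ) ^ θ = hr := by
    rw [hhr, Real.rpow_sub hy0, Real.rpow_one]
  -- block `j`: `P = y − (j−1)h`, `P − h = y − jh`
  have hblock : ∀ j ∈ Finset.Icc 1 J, y - (j - 1) * h - h = y - j * h ∧ h ≤ y - (j - 1) * h ∧ y - (j - 1) * h ≤ y := by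
    intro j hj
    obtain ⟨hj1, hjJ⟩ := Finset.mem_Icc.mp hj
    have hjh : j * h ≤ y := le_trans (Nat.mul_le_mul_right h hjJ) hJhy
    have : j * h = (j - 1) * h + h := by
      calc j * h = ((j - 1) + 1) * h := by rw [Nat.sub_add_cancel hj1]
        _ = (j - 1) * h + h := by ring
    refine ⟨by omega, by omega, Nat.sub_le _ _⟩
  -- regularity from the trivial character
  have hreg : ∀ j ∈ Finset.Icc 1 J, |(∑ p ∈ primeBlock (y - j * h) (y - (j - 1) * h), Real.log p) - h| ≤ (2 * δ₀) * h := by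
    intro j hj
    obtain ⟨hPh, hhP, hPy⟩ := hblock j hj
    have hG := hgood 1 (1 : DirichletCharacter ℂ 1) DirichletCharacter.isPrimitive_one_level_one le_rfl hfloor1
      (y - (j - 1) * h) h hPy (le_trans hhP hPy)
    rw [gallagherTerm_one hhP, hPh, Complex.norm_real, Real.norm_eq_abs, hyyθ] at hG
    refine hG.trans ?_
    nlinarith [hh_ge]
  -- cancellation from the primitive character inducing `χ`
  have hcan : ∀ j ∈ Finset.Icc 1 J, ‖∑ p ∈ primeBlock (y - j * h) (y - (j - 1) * h),
      χ (p : ZMod q') * (Real.log p : ℂ)‖ ≤ (2 * δ₀) * h := by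
    intro j hj
    obtain ⟨hPh, hhP, hPy⟩ := hblock j hj
    set r : ℕ := χ.conductor with hr_def
    haveI : NeZero r := ⟨χ.conductor_ne_zero⟩
    have hr1 : r ≠ 1 := fun h1 => hχ (DirichletCharacter.eq_one_iff_conductor_eq_one.mpr h1)
    have hr1' : 1 ≤ r := Nat.one_le_iff_ne_zero.mpr (NeZero.ne r)
    have hrq : r ≤ q' := Nat.le_of_dvd (Nat.pos_of_ne_zero (NeZero.ne q')) χ.conductor_dvd_level
    have hrfloor : r ≤ ⌊(y : ℝ) ^ θ⌋₊ := Nat.le_floor (le_trans (by exact_mod_cast hrq) hq')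
    have hG := hgood r χ.primitiveCharacter χ.primitiveCharacter_isPrimitive hr1' hrfloor (y - (j - 1) * h) h hPy (le_trans hhP hPy)
    rw [gallagherTerm, if_neg hr1, sub_zero, charPrimeSum, hPh, hyyθ] at hG
    -- identify the two sums
    have hsum : ∑ p ∈ primeBlock (y - j * h) (y - (j - 1) * h), χ (p : ZMod q') * (Real.log p : ℂ) =
        ∑ p ∈ (Finset.Ioc (y - j * h) (y - (j - 1) * h)).filter Nat.Prime, χ.primitiveCharacter (p : ZMod r) * (Real.log p : ℂ) := by
      refine Finset.sum_congr rfl fun p hp => ?_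
      obtain ⟨⟨hp1, -⟩, hpP⟩ := mem_primeBlock.mp hp
      have hqp : q' < p := by
        have h1 : ((y - J * h : ℕ) : ℝ) < p := by
          have : y - J * h < p := lt_of_le_of_lt (by
            have := Finset.mem_Icc.mp hj; exact Nat.sub_le_sub_left (Nat.mul_le_mul_right h this.2) y) hp1
          exact_mod_cast this
        have h2 : (q' : ℝ) < p := by linarith [hq', hyq, hLger]
        exact_mod_cast h2
      rw [apply_eq_primitiveCharacter χ (coprime_of_prime_gt hpP (Nat.pos_of_ne_zero (NeZero.ne q')) hqp)]
    rw [hsum]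
    refine hG.trans ?_
    nlinarith [hh_ge]
  -- ### the block estimate
  have hz : ∀ p : ℕ, ‖χ (p : ZMod q')‖ ≤ 1 := fun p => DirichletCharacter.norm_le_one χ _
  have hB := sum_blocks_decay_lower_bound hJhy hh1 h20 hlogL20 hlogY (fun p => χ (p : ZMod q')) hz
    (by positivity : (0 : ℝ) ≤ 2 * δ₀) (by linarith) hreg hcan hα0 hα1 hth
  -- ### compare with the whole sum over `p ≤ y` and with the integral
  have hsub : ∑ p ∈ primeBlock (y - J * h) y, (p : ℝ) ^ (-α) * (1 - (χ (p : ZMod q') * (p : ℂ) ^ (-((t : ℂ) * I))).re) ≤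
      ∑ p ∈ Nat.primesLE y, (p : ℝ) ^ (-α) * (1 - (χ (p : ZMod q') * (p : ℂ) ^ (-((t : ℂ) * I))).re) := by
    refine Finset.sum_le_sum_of_subset_of_nonneg ?_ fun p hp _ => ?_
    · intro p hp
      obtain ⟨⟨-, hpy⟩, hpP⟩ := mem_primeBlock.mp hp
      exact Nat.mem_primesLE.mpr ⟨hpy, hpP⟩
    · have hp0 : 0 < p := (Nat.mem_primesLE.mp hp).2.pos
      have hre : (χ (p : ZMod q') * (p : ℂ) ^ (-((t : ℂ) * I))).re ≤ 1 := by
        refine (Complex.re_le_norm _).trans ?_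
        rw [norm_mul, Complex.norm_natCast_cpow_of_pos hp0]
        simpa using hz p
      have : 0 ≤ (p : ℝ) ^ (-α) := by positivity
      nlinarith
  have hint := integral_le_sum_blocks hJhy hLposN hα0 (y := y) (h := h) (J := J)
  -- `∫_{3Y₁r}^{y} ≤ ∫_{y−Jh+h}^{y+h}` (nonnegative integrand, smaller interval)
  have hI2 : ∫ v in (3 * (y : ℝ) ^ (1 - θ / 2))..(y : ℝ), v ^ (-α) ≤
      ∫ v in (((y - J * h + h : ℕ) : ℝ))..(((y + h : ℕ) : ℝ)), v ^ (-α) := by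
    have hLlt' : ((y - J * h : ℕ) : ℝ) < (Y₁ : ℝ) + h := by exact_mod_cast hLlt
    have hlo : ((y - J * h + h : ℕ) : ℝ) ≤ 3 * (y : ℝ) ^ (1 - θ / 2) := by
      have e : ((y - J * h + h : ℕ) : ℝ) = ((y - J * h : ℕ) : ℝ) + h := by push_cast; ring
      rw [e]
      nlinarith [hLlt', hY₁_le, hh_le, hy40, hhr1]
    have hhi : (y : ℝ) ≤ ((y + h : ℕ) : ℝ) := by push_cast; linarith [(Nat.cast_nonneg h : (0:ℝ) ≤ h)]
    have hlopos : 0 < ((y - J * h + h : ℕ) : ℝ) := by positivity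
    refine intervalIntegral.integral_mono_interval hlo (by linarith) hhi ?_ ?_
    · exact (ae_restrict_iff' measurableSet_Ioc).mpr (Filter.Eventually.of_forall fun v hv =>
        Real.rpow_nonneg (hlopos.le.trans hv.1.le) _)
    · refine ContinuousOn.intervalIntegrable fun v hv => ?_
      have hab : ((y - J * h + h : ℕ) : ℝ) ≤ ((y + h : ℕ) : ℝ) := hlo.trans ((by linarith : (3 : ℝ) * (y : ℝ) ^ (1 - θ / 2) ≤ y).trans hhi)
      rw [Set.uIcc_of_le hab] at hv
      exact (Real.continuousAt_rpow_const v (-α) (Or.inl (lt_of_lt_of_le hlopos hv.1).ne')).continuousWithinAt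
  -- assemble
  have hI0 : 0 ≤ ∫ v in (3 * (y : ℝ) ^ (1 - θ / 2))..(y : ℝ), v ^ (-α) :=
    intervalIntegral.integral_nonneg (by linarith) fun v hv => Real.rpow_nonneg (by nlinarith [hv.1, hY₁r0]) _
  calc 1 / (4 * Real.log y) * ∫ v in (3 * (y : ℝ) ^ (1 - θ / 2))..(y : ℝ), v ^ (-α)
      ≤ 1 / (4 * Real.log y) * ∑ j ∈ Finset.Icc 1 J, (h : ℝ) * (((y - (j - 1) * h : ℕ) : ℝ)) ^ (-α) :=
        mul_le_mul_of_nonneg_left (hI2.trans hint) (by positivity)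
    _ = 1 / 4 * ∑ j ∈ Finset.Icc 1 J, ((h : ℝ) * (((y - (j - 1) * h : ℕ) : ℝ)) ^ (-α) / Real.log y) := by
        rw [Finset.mul_sum, Finset.mul_sum]
        refine Finset.sum_congr rfl fun j _ => ?_
        field_simp
    _ ≤ _ := hB.trans hsub

end SmoothArcs

end Literature.NumberTheory.Sieve

end
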